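import Literature.Topology.FourManifolds.FlowerMelon
import Literature.Topology.FourManifolds.DehnNielsenBaerGenerators
import HarnessLib

/-!
# Dehn–Nielsen–Baer on the flower surface: ambient symmetries as based diffeomorphisms of `∂V_g`

Topic `Literature/Topology/FourManifolds`; fourth PROOF file of the named fact
`Literature.Topology.FourManifolds.DehnNielsenBaerSurfaceSmooth` (`DehnNielsenBaerSurface.lean`), after
`DehnNielsenBaerSurfaceProofs.lean`, `DehnNielsenBaerTorus.lean` (genus `≤ 1` proved, reduction of genus
`≥ 2` to the flower surfaces `∂V_g = ∂(FlowerModel.FlowerHandlebody hg)`) and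
`DehnNielsenBaerGenerators.lean` (`dehnNielsenBaerSurfaceSmooth_of_flower_generators`: it remains to
realise, by diffeomorphisms of `∂V_g`, one set of automorphisms of `π₁(∂V_g, x₀)` generating `Aut π₁`
together with `Inn π₁`).  This file supplies the **mechanism by which explicit diffeomorphisms of the
flower surface are produced** and its first two instances:

* `FlowerModel.lift3Diffeo`, `rot3Diffeo`, `refl3Diffeo` — the rotations about the `z`-axis and the
  reflection in the `xz`-plane (`FlowerSymmetry.lean`: `rot3`, `refl3`, there as homeomorphisms) as
  diffeomorphisms of `ℝ³`;
* `FlowerModel.boundarySymm hg e he` — **every diffeomorphism `e` of `ℝ³` preserving the thickened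
  flower `q_g(x, y) + z²` restricts to a self-diffeomorphism of the boundary `∂V_g`** of the flower
  handlebody `V_g = {q_g + z² ≤ c_g}` (an instance of `RegularSublevel.boundaryRestrictDiffeomorph`,
  `RegularSublevelMaps.lean`; Lee (2013), Cor. 5.30), commuting with the inclusion `∂V_g → ℝ³`
  (`boundaryIncl_boundarySymm`), functorial (`boundarySymm_trans_apply`), and fixing a boundary point
  iff `e` fixes it in `ℝ³` (`boundarySymm_apply_eq_iff`) — the gateway for the symmetries here and for
  the Dehn twists of the sequel (flows of fields tangent to the level sets of `q_g + z²` also preserve it);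
* `FlowerModel.northPole hg` — the base point `x₀ = (0, 0, √c_g) ∈ ∂V_g` (the upper pole `top g` of the
  melon decomposition, `FlowerMelon.lean`), fixed by all rotations and by the reflection
  (`rotBoundary_northPole`, `reflBoundary_northPole`);
* `FlowerModel.rotBoundary hg j`, `reflBoundary hg` — the rotation by `2πj/g` and the reflection as
  BASED diffeomorphisms of `(∂V_g, x₀)`, with `reflBoundary` an involution and
  `rotBoundary hg g = id` (`rotBoundary_period`);
* `exists_diffeomorph_path_map_eq_fundamentalGroupCongr` (general) — **a based diffeomorphism
  outer-realises the automorphism `f_#` of `π₁(M, x)` it induces, and `f⁻¹` realises `f_#⁻¹`**, in the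
  exact hypothesis shape of `dehnNielsenBaerSurfaceSmooth_of_flower_generators`; whence
  (`realised_rotBoundary`, `realised_reflBoundary`) the automorphisms `(ρ_j)_#`, `σ_#` of
  `π₁(∂V_g, x₀)` induced by the rotations and the reflection may be put into the generating set `S`
  of that reduction at no further cost.  (`σ` reverses orientation — `HandlebodyMirrorSymmetry.lean`
  proves this for the reflection in the `xy`-plane, the same mechanism — so `σ_#` is the
  orientation-reversing generator of `Out π₁ = Mod^±`, Farb–Margalit (2012), Thm. 8.1; the rotation
  cyclically permutes the `g` one-holed tori of the melon decomposition.)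

Everything here is proved; the definitions are concrete diffeomorphisms and a point; no named fact is
introduced (D-0026).  What is NOT here: the action of `ρ_j`, `σ` on the marking
`S_g ≅ π₁(∂V_g, x₀)` (`FlowerModel.flowerSurface_marking` is a bare `Nonempty`), and the Dehn twists.

## References

* B. Farb, D. Margalit, *A primer on mapping class groups*, PMS 49 (2012), Thm. 8.1 and §8.1
  (PDF pp. 190–191: `Mod^±(S_g) → Out π₁(S_g)`, orientation-reversing classes included), §1.4 /
  Thm. 1.13 (smooth representatives). [FarbMargalit2012]
* H. Zieschang, E. Vogt, H.-D. Coldewey, *Surfaces and planar discontinuous groups*, LNM 835 (1980),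
  Thm. 5.6.2 and its proof (PDF pp. 165–166: the reflection-type homeomorphism `τ_i ↦ μ_{g+1-i}`
  realising `Π_* ↦ Π_*⁻¹`). [ZieschangVogtColdewey1980]
* J. M. Lee, *Introduction to Smooth Manifolds*, 2nd ed. (2013), Cor. 5.30. [LeeSmoothManifolds2013]
-/

open scoped Manifold ContDiff Topology
open Set Function

noncomputable section

namespace Literature.Topology.FourManifolds

open Literature.AlgebraicTopology.FundamentalGroup PlanarThickening

/-- Local notation: `𝔼 n` is the model Euclidean space `EuclideanSpace ℝ (Fin n)`. -/
local notation "𝔼 " n:arg => EuclideanSpace ℝ (Fin n)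

/-! ### §1 A based diffeomorphism outer-realises its own automorphism of `π₁` -/

section Based

variable {n : ℕ} {M : Type*} [TopologicalSpace M] [ChartedSpace (𝔼 n) M]

/-- `f_*` at the base point `x`, read along the constant path recast as a path from `y` to `f x`
along `f x = y`, is the based homomorphism `mapOfEq f`. [folklore] -/
theorem map_eq_fundamentalGroupMulEquivOfPath_cast_mapOfEq {X Y : Type*} [TopologicalSpace X]
    [TopologicalSpace Y] (F : C(X, Y)) {x : X} {y : Y} (h : F x = y) (γ : FundamentalGroup X x) :
    FundamentalGroup.map F x γ =
      FundamentalGroup.fundamentalGroupMulEquivOfPath ((Path.refl y).cast rfl h)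
        (FundamentalGroup.mapOfEq F h γ) := by
  subst h
  rw [mapOfEq_rfl_apply]
  exact (fundamentalGroupMulEquivOfPath_refl_apply' (F x) _).symm

/-- **A based diffeomorphism outer-realises the automorphism of `π₁(M, x)` it induces, and its inverse
realises the inverse automorphism** — the two clauses of the hypothesis of
`dehnNielsenBaerSurfaceSmooth_of_flower_generators` for `θ = f_#`
(`Homeomorph.fundamentalGroupCongr`), witnessed by `(f, const)` and `(f⁻¹, const)`.
[cite: FarbMargalit2012, Thm. 8.1 and §8.1] -/
theorem exists_diffeomorph_path_map_eq_fundamentalGroupCongr (f : M ≃ₘ⟮𝓡 n, 𝓡 n⟯ M) {x : M}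
    (hf : f x = x) :
    (∃ (f' : M ≃ₘ⟮𝓡 n, 𝓡 n⟯ M) (p : Path x (f' x)), ∀ γ,
      FundamentalGroup.map (⟨f', f'.continuous⟩ : C(M, M)) x γ =
        FundamentalGroup.fundamentalGroupMulEquivOfPath p
          (Homeomorph.fundamentalGroupCongr f.toHomeomorph hf γ)) ∧
    (∃ (f' : M ≃ₘ⟮𝓡 n, 𝓡 n⟯ M) (p : Path x (f' x)), ∀ γ,
      FundamentalGroup.map (⟨f', f'.continuous⟩ : C(M, M)) x γ =
        FundamentalGroup.fundamentalGroupMulEquivOfPath p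
          ((Homeomorph.fundamentalGroupCongr f.toHomeomorph hf)⁻¹ γ)) := by
  have hf' : f.symm x = x := by
    conv_lhs => rw [← hf]
    exact f.symm_apply_apply x
  refine ⟨⟨f, (Path.refl x).cast rfl hf, fun γ => ?_⟩, ⟨f.symm, (Path.refl x).cast rfl hf', fun γ => ?_⟩⟩
  · rw [Homeomorph.fundamentalGroupCongr_apply]
    exact map_eq_fundamentalGroupMulEquivOfPath_cast_mapOfEq ⟨f, f.continuous⟩ hf γ
  · rw [MulAut.inv_def, Homeomorph.fundamentalGroupCongr_symm_apply]
    exact map_eq_fundamentalGroupMulEquivOfPath_cast_mapOfEq ⟨f.symm, f.symm.continuous⟩ hf' γ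

end Based

namespace FlowerModel

variable {g : ℕ}

/-! ### §2 The rotations and the reflection as diffeomorphisms of `ℝ³` -/

/-- The lift `(x, y, z) ↦ (f(x, y), z)` of a smooth planar map is smooth. [folklore] -/
theorem contDiff_lift3 {f : 𝔼 2 → 𝔼 2} (hf : ContDiff ℝ ∞ f) : ContDiff ℝ ∞ (lift3 f) := by
  have h1 : ContDiff ℝ ∞ (fun p : 𝔼 3 => lift (f (proj p))) := lift.contDiff.comp (hf.comp proj.contDiff)
  have h2 : ContDiff ℝ ∞ (fun p : 𝔼 3 => (zc p) • ez) := (zc : 𝔼 3 →L[ℝ] ℝ).contDiff.smul contDiff_const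
  exact h1.add h2

/-- **The lift of a pair of mutually inverse smooth planar maps as a diffeomorphism of `ℝ³`** (the
smooth version of `lift3Homeomorph`). [folklore] -/
def lift3Diffeo (f f' : 𝔼 2 → 𝔼 2) (hf : ContDiff ℝ ∞ f) (hf' : ContDiff ℝ ∞ f')
    (h₁ : ∀ u, f' (f u) = u) (h₂ : ∀ u, f (f' u) = u) : 𝔼 3 ≃ₘ⟮𝓡 3, 𝓡 3⟯ 𝔼 3 where
  toEquiv := (lift3Homeomorph f f' hf.continuous hf'.continuous h₁ h₂).toEquiv
  contMDiff_toFun := (contDiff_lift3 hf).contMDiff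
  contMDiff_invFun := (contDiff_lift3 hf').contMDiff

/-- **The rotation of `ℝ³` about the `z`-axis** by `a ∈ S¹`, as a diffeomorphism. [folklore] -/
def rot3Diffeo (a : Circle) : 𝔼 3 ≃ₘ⟮𝓡 3, 𝓡 3⟯ 𝔼 3 :=
  lift3Diffeo (rot a) (rot a⁻¹) (rot a).contDiff (rot a⁻¹).contDiff (rot_inv_rot a) (rot_rot_inv a)

/-- **The reflection of `ℝ³` in the `xz`-plane**, as a diffeomorphism. [folklore] -/
def refl3Diffeo : 𝔼 3 ≃ₘ⟮𝓡 3, 𝓡 3⟯ 𝔼 3 :=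
  lift3Diffeo refl refl refl.contDiff refl.contDiff refl_refl refl_refl

/-- `rot3Diffeo` is `rot3` on points. [folklore] -/
@[simp] theorem rot3Diffeo_apply (a : Circle) (p : 𝔼 3) : rot3Diffeo a p = rot3 a p := rfl

/-- `refl3Diffeo` is `refl3` on points. [folklore] -/
@[simp] theorem refl3Diffeo_apply (p : 𝔼 3) : refl3Diffeo p = refl3 p := rfl

/-- Every rotation about the `z`-axis fixes the upper pole. [folklore] -/
theorem rot3_top (a : Circle) (g : ℕ) : rot3 a (top g) = top g := by
  rw [top, rot3_apply, map_add, map_smul, proj_lift, proj_ez, smul_zero, add_zero, map_zero]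
  simp

/-! ### §3 Thicken-preserving diffeomorphisms of `ℝ³` act on `∂V_g` -/

/-- **A diffeomorphism of `ℝ³` preserving `q_g(x, y) + z²` restricts to a self-diffeomorphism of the
boundary `∂V_g` of the flower handlebody** (`RegularSublevel.boundaryRestrictDiffeomorph`; Lee (2013),
Cor. 5.30: smooth maps into an embedded submanifold). [cite: LeeSmoothManifolds2013, Cor. 5.30] -/
def boundarySymm (hg : 2 ≤ g) (e : 𝔼 3 ≃ₘ⟮𝓡 3, 𝓡 3⟯ 𝔼 3)
    (he : ∀ p, thicken (flower g) (e p) = thicken (flower g) p) :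
    (𝓡∂ 3).boundary (FlowerHandlebody hg) ≃ₘ⟮𝓡 2, 𝓡 2⟯ (𝓡∂ 3).boundary (FlowerHandlebody hg) :=
  RegularSublevel.boundaryRestrictDiffeomorph (isHoledDiscMorseFunction_flower hg).isRegularLevel
    (isHoledDiscMorseFunction_flower hg).isRegularLevel e he

/-- `boundarySymm hg e he` is `e` on points of `ℝ³`. [folklore] -/
@[simp] theorem boundaryIncl_boundarySymm (hg : 2 ≤ g) (e : 𝔼 3 ≃ₘ⟮𝓡 3, 𝓡 3⟯ 𝔼 3)
    (he : ∀ p, thicken (flower g) (e p) = thicken (flower g) p)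
    (z : (𝓡∂ 3).boundary (FlowerHandlebody hg)) :
    boundaryIncl hg (boundarySymm hg e he z) = e (boundaryIncl hg z) := rfl

/-- Two points of `∂V_g` are equal iff they are equal in `ℝ³`. [folklore] -/
theorem boundaryIncl_inj (hg : 2 ≤ g) {z z' : (𝓡∂ 3).boundary (FlowerHandlebody hg)} :
    boundaryIncl hg z = boundaryIncl hg z' ↔ z = z' :=
  (isEmbedding_boundaryIncl hg).injective.eq_iff

/-- `boundarySymm` fixes a boundary point iff `e` fixes it in `ℝ³`. [folklore] -/
theorem boundarySymm_apply_eq_iff (hg : 2 ≤ g) (e : 𝔼 3 ≃ₘ⟮𝓡 3, 𝓡 3⟯ 𝔼 3)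
    (he : ∀ p, thicken (flower g) (e p) = thicken (flower g) p)
    (z z' : (𝓡∂ 3).boundary (FlowerHandlebody hg)) :
    boundarySymm hg e he z = z' ↔ e (boundaryIncl hg z) = boundaryIncl hg z' := by
  rw [← boundaryIncl_inj hg, boundaryIncl_boundarySymm]

/-- **Functoriality**: `boundarySymm` of a composite is the composite. [folklore] -/
theorem boundarySymm_trans_apply (hg : 2 ≤ g) (e₁ e₂ : 𝔼 3 ≃ₘ⟮𝓡 3, 𝓡 3⟯ 𝔼 3)
    (he₁ : ∀ p, thicken (flower g) (e₁ p) = thicken (flower g) p)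
    (he₂ : ∀ p, thicken (flower g) (e₂ p) = thicken (flower g) p)
    (z : (𝓡∂ 3).boundary (FlowerHandlebody hg)) :
    boundarySymm hg (e₁.trans e₂) (fun p => by rw [Diffeomorph.coe_trans, comp_apply, he₂, he₁]) z =
      boundarySymm hg e₂ he₂ (boundarySymm hg e₁ he₁ z) := by
  rw [← boundaryIncl_inj hg]; rfl

/-- The inverse of `boundarySymm hg e` is `boundarySymm hg e⁻¹`. [folklore] -/
theorem boundarySymm_symm_apply (hg : 2 ≤ g) (e : 𝔼 3 ≃ₘ⟮𝓡 3, 𝓡 3⟯ 𝔼 3)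
    (he : ∀ p, thicken (flower g) (e p) = thicken (flower g) p)
    (z : (𝓡∂ 3).boundary (FlowerHandlebody hg)) :
    (boundarySymm hg e he).symm z =
      boundarySymm hg e.symm (fun p => by rw [← he (e.symm p), e.apply_symm_apply]) z := by
  rw [← boundaryIncl_inj hg]; rfl

/-! ### §4 The base point: the upper pole -/

/-- **The base point `x₀ = (0, 0, √c_g)` of `∂V_g`**, the upper pole of the melon decomposition.
[folklore] -/
def northPole (hg : 2 ≤ g) : (𝓡∂ 3).boundary (FlowerHandlebody hg) :=
  (boundaryHomeomorph hg).symm ⟨top g, thicken_top (by omega)⟩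

/-- The base point is the upper pole `top g` in `ℝ³`. [folklore] -/
@[simp] theorem boundaryIncl_northPole (hg : 2 ≤ g) : boundaryIncl hg (northPole hg) = top g := by
  have h := (boundaryHomeomorph hg).apply_symm_apply ⟨top g, thicken_top (by omega)⟩
  exact congrArg Subtype.val h

/-- A thicken-preserving diffeomorphism fixing the upper pole in `ℝ³` fixes the base point of `∂V_g`.
[folklore] -/
theorem boundarySymm_northPole (hg : 2 ≤ g) (e : 𝔼 3 ≃ₘ⟮𝓡 3, 𝓡 3⟯ 𝔼 3)
    (he : ∀ p, thicken (flower g) (e p) = thicken (flower g) p) (htop : e (top g) = top g) :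
    boundarySymm hg e he (northPole hg) = northPole hg := by
  rw [boundarySymm_apply_eq_iff, boundaryIncl_northPole, htop]

/-! ### §5 The rotations and the reflection of `(∂V_g, x₀)` -/

/-- **The rotation `ρ_j` of `∂V_g` by `2πj/g` about the `z`-axis** (a diffeomorphism: the flower is
invariant under the `g`-th roots of unity, `thicken_flower_rot3`). [folklore] -/
def rotBoundary (hg : 2 ≤ g) (j : ℕ) :
    (𝓡∂ 3).boundary (FlowerHandlebody hg) ≃ₘ⟮𝓡 2, 𝓡 2⟯ (𝓡∂ 3).boundary (FlowerHandlebody hg) :=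
  boundarySymm hg (rot3Diffeo (ζC g j)) fun p => thicken_flower_rot3 (ζC_pow (by omega) j) p

/-- **The reflection `σ` of `∂V_g` in the `xz`-plane** (a diffeomorphism: `thicken_flower_refl3`).
[folklore] -/
def reflBoundary (hg : 2 ≤ g) :
    (𝓡∂ 3).boundary (FlowerHandlebody hg) ≃ₘ⟮𝓡 2, 𝓡 2⟯ (𝓡∂ 3).boundary (FlowerHandlebody hg) :=
  boundarySymm hg refl3Diffeo thicken_flower_refl3

/-- `ρ_j` is the rotation `rot3 (ζ^j)` on points of `ℝ³`. [folklore] -/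
@[simp] theorem boundaryIncl_rotBoundary (hg : 2 ≤ g) (j : ℕ) (z : (𝓡∂ 3).boundary (FlowerHandlebody hg)) :
    boundaryIncl hg (rotBoundary hg j z) = rot3 (ζC g j) (boundaryIncl hg z) := rfl

/-- `σ` is the reflection `refl3` on points of `ℝ³`. [folklore] -/
@[simp] theorem boundaryIncl_reflBoundary (hg : 2 ≤ g) (z : (𝓡∂ 3).boundary (FlowerHandlebody hg)) :
    boundaryIncl hg (reflBoundary hg z) = refl3 (boundaryIncl hg z) := rfl

/-- **`ρ_j` fixes the base point.** [folklore] -/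
theorem rotBoundary_northPole (hg : 2 ≤ g) (j : ℕ) : rotBoundary hg j (northPole hg) = northPole hg :=
  boundarySymm_northPole hg _ _ (rot3_top _ g)

/-- **`σ` fixes the base point.** [folklore] -/
theorem reflBoundary_northPole (hg : 2 ≤ g) : reflBoundary hg (northPole hg) = northPole hg :=
  boundarySymm_northPole hg _ _ (refl3_top g)

/-- `σ` is an involution. [folklore] -/
@[simp] theorem reflBoundary_reflBoundary (hg : 2 ≤ g) (z : (𝓡∂ 3).boundary (FlowerHandlebody hg)) :
    reflBoundary hg (reflBoundary hg z) = z := by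
  rw [← boundaryIncl_inj hg, boundaryIncl_reflBoundary, boundaryIncl_reflBoundary, refl3_refl3]

/-- `ρ_0` is the identity. [folklore] -/
theorem rotBoundary_zero (hg : 2 ≤ g) (z : (𝓡∂ 3).boundary (FlowerHandlebody hg)) :
    rotBoundary hg 0 z = z := by
  rw [← boundaryIncl_inj hg, boundaryIncl_rotBoundary]
  have h0 : ζC g 0 = 1 := by simp [ζC]
  rw [h0, rot3_apply]
  have : rot 1 (proj (boundaryIncl hg z)) = proj (boundaryIncl hg z) := by
    simp [rot]
  rw [this, lift_proj_add]

/-- `ρ_j ∘ ρ_k = ρ_{j+k}`. [folklore] -/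
theorem rotBoundary_rotBoundary (hg : 2 ≤ g) (j k : ℕ) (z : (𝓡∂ 3).boundary (FlowerHandlebody hg)) :
    rotBoundary hg j (rotBoundary hg k z) = rotBoundary hg (j + k) z := by
  rw [← boundaryIncl_inj hg, boundaryIncl_rotBoundary, boundaryIncl_rotBoundary, boundaryIncl_rotBoundary]
  have hζ : ζC g (j + k) = ζC g j * ζC g k := by
    apply Subtype.ext
    simp only [coe_ζC, Circle.coe_mul, pow_add]
  rw [hζ]
  change lift3 (rot (ζC g j)) (lift3 (rot (ζC g k)) (boundaryIncl hg z)) = lift3 (rot (ζC g j * ζC g k)) (boundaryIncl hg z)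
  rw [lift3_lift3]
  congr 1
  funext p
  exact rot_rot _ _ p

/-- **`ρ_g` is the identity**: the rotations form a cyclic group of order `g`. [folklore] -/
theorem rotBoundary_period (hg : 2 ≤ g) (z : (𝓡∂ 3).boundary (FlowerHandlebody hg)) :
    rotBoundary hg g z = z := by
  rw [← boundaryIncl_inj hg, boundaryIncl_rotBoundary]
  have h1 : ζC g g = 1 := by
    apply Subtype.ext
    rw [coe_ζC, ← Complex.exp_nat_mul, Circle.coe_one]
    have hg0 : (g : ℂ) ≠ 0 := by exact_mod_cast (show g ≠ 0 by omega)
    rw [show (g : ℂ) * (2 * Real.pi * Complex.I / g) = 2 * Real.pi * Complex.I by field_simp]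
    exact Complex.exp_two_pi_mul_I
  rw [h1, rot3_apply]
  have : rot 1 (proj (boundaryIncl hg z)) = proj (boundaryIncl hg z) := by simp [rot]
  rw [this, lift_proj_add]

/-- `σ ∘ ρ_j = ρ_j⁻¹ ∘ σ`: the dihedral relation, in the form `σ ρ_j σ ρ_j = id`. [folklore] -/
theorem reflBoundary_rotBoundary_reflBoundary_rotBoundary (hg : 2 ≤ g) (j : ℕ)
    (z : (𝓡∂ 3).boundary (FlowerHandlebody hg)) :
    reflBoundary hg (rotBoundary hg j (reflBoundary hg (rotBoundary hg j z))) = z := by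
  rw [← boundaryIncl_inj hg, boundaryIncl_reflBoundary, boundaryIncl_rotBoundary, boundaryIncl_reflBoundary,
    boundaryIncl_rotBoundary]
  set p := boundaryIncl hg z
  change lift3 refl (lift3 (rot (ζC g j)) (lift3 refl (lift3 (rot (ζC g j)) p))) = p
  rw [lift3_lift3, lift3_lift3, lift3_lift3]
  have : ((⇑refl ∘ ⇑(rot (ζC g j))) ∘ ⇑refl) ∘ ⇑(rot (ζC g j)) = id := by
    funext u
    simp only [comp_apply, id_eq]
    rw [refl_rot (ζC g j) (refl (rot (ζC g j) u)), refl_refl]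
    exact rot_inv_rot _ u
  rw [this, lift3_id]

/-! ### §6 The induced automorphisms of `π₁(∂V_g, x₀)` are realised -/

/-- **The automorphism `(ρ_j)_#` of `π₁(∂V_g, x₀)` and its inverse are outer-realised by
diffeomorphisms** (by `ρ_j^{±1}` itself), in the hypothesis shape of
`dehnNielsenBaerSurfaceSmooth_of_flower_generators`. [cite: FarbMargalit2012, Thm. 8.1 and §8.1] -/
theorem realised_rotBoundary (hg : 2 ≤ g) (j : ℕ) :
    (∃ (f : (𝓡∂ 3).boundary (FlowerHandlebody hg) ≃ₘ⟮𝓡 2, 𝓡 2⟯ (𝓡∂ 3).boundary (FlowerHandlebody hg))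
        (p : Path (northPole hg) (f (northPole hg))), ∀ γ,
      FundamentalGroup.map (⟨f, f.continuous⟩ : C(_, _)) (northPole hg) γ =
        FundamentalGroup.fundamentalGroupMulEquivOfPath p
          (Homeomorph.fundamentalGroupCongr (rotBoundary hg j).toHomeomorph (rotBoundary_northPole hg j) γ)) ∧
    (∃ (f : (𝓡∂ 3).boundary (FlowerHandlebody hg) ≃ₘ⟮𝓡 2, 𝓡 2⟯ (𝓡∂ 3).boundary (FlowerHandlebody hg))
        (p : Path (northPole hg) (f (northPole hg))), ∀ γ,
      FundamentalGroup.map (⟨f, f.continuous⟩ : C(_, _)) (northPole hg) γ =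
        FundamentalGroup.fundamentalGroupMulEquivOfPath p
          ((Homeomorph.fundamentalGroupCongr (rotBoundary hg j).toHomeomorph (rotBoundary_northPole hg j))⁻¹ γ)) :=
  exists_diffeomorph_path_map_eq_fundamentalGroupCongr (rotBoundary hg j) (rotBoundary_northPole hg j)

/-- **The automorphism `σ_#` of `π₁(∂V_g, x₀)` and its inverse are outer-realised by
diffeomorphisms** (by the reflection `σ` itself; `σ_#` is the orientation-reversing generator of
`Out π₁(∂V_g) = Mod^±(∂V_g)`, Zieschang–Vogt–Coldewey (1980), proof of Thm. 5.6.2: a reflection-type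
homeomorphism realises `Π_* ↦ Π_*⁻¹`). [cite: ZieschangVogtColdewey1980, Thm. 5.6.2 (proof)] -/
theorem realised_reflBoundary (hg : 2 ≤ g) :
    (∃ (f : (𝓡∂ 3).boundary (FlowerHandlebody hg) ≃ₘ⟮𝓡 2, 𝓡 2⟯ (𝓡∂ 3).boundary (FlowerHandlebody hg))
        (p : Path (northPole hg) (f (northPole hg))), ∀ γ,
      FundamentalGroup.map (⟨f, f.continuous⟩ : C(_, _)) (northPole hg) γ =
        FundamentalGroup.fundamentalGroupMulEquivOfPath p
          (Homeomorph.fundamentalGroupCongr (reflBoundary hg).toHomeomorph (reflBoundary_northPole hg) γ)) ∧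
    (∃ (f : (𝓡∂ 3).boundary (FlowerHandlebody hg) ≃ₘ⟮𝓡 2, 𝓡 2⟯ (𝓡∂ 3).boundary (FlowerHandlebody hg))
        (p : Path (northPole hg) (f (northPole hg))), ∀ γ,
      FundamentalGroup.map (⟨f, f.continuous⟩ : C(_, _)) (northPole hg) γ =
        FundamentalGroup.fundamentalGroupMulEquivOfPath p
          ((Homeomorph.fundamentalGroupCongr (reflBoundary hg).toHomeomorph (reflBoundary_northPole hg))⁻¹ γ)) :=
  exists_diffeomorph_path_map_eq_fundamentalGroupCongr (reflBoundary hg) (reflBoundary_northPole hg)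

/-- **Reduction of `DehnNielsenBaerSurfaceSmooth` to generators, with the symmetries discounted**: it
suffices that, for each `g ≥ 2`, some set `S` of automorphisms of `π₁(∂V_g, x₀)` — `x₀` the upper pole —
each outer-realised together with its inverse, generates `Aut π₁(∂V_g, x₀)` together with the inner
automorphisms, the rotations `(ρ_j)_#` and the reflection `σ_#` (the latter being realised here).
[cite: FarbMargalit2012, Thm. 8.1 and Thm. 4.1] -/
theorem dehnNielsenBaerSurfaceSmooth_of_flower_generators_symm
    (hgen : ∀ (g : ℕ) (hg : 2 ≤ g),
      ∃ (S : Set (FundamentalGroup ((𝓡∂ 3).boundary (FlowerHandlebody hg)) (northPole hg) ≃*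
        FundamentalGroup ((𝓡∂ 3).boundary (FlowerHandlebody hg)) (northPole hg))),
      Subgroup.closure (S ∪
        (Set.range fun j : ℕ => Homeomorph.fundamentalGroupCongr (rotBoundary hg j).toHomeomorph
          (rotBoundary_northPole hg j)) ∪
        {Homeomorph.fundamentalGroupCongr (reflBoundary hg).toHomeomorph (reflBoundary_northPole hg)} ∪
        Set.range (MulAut.conj
          (G := FundamentalGroup ((𝓡∂ 3).boundary (FlowerHandlebody hg)) (northPole hg)))) = ⊤ ∧
      ∀ θ ∈ S, (∃ (f : (𝓡∂ 3).boundary (FlowerHandlebody hg) ≃ₘ⟮𝓡 2, 𝓡 2⟯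
            (𝓡∂ 3).boundary (FlowerHandlebody hg)) (p : Path (northPole hg) (f (northPole hg))), ∀ γ,
          FundamentalGroup.map (⟨f, f.continuous⟩ : C(_, _)) (northPole hg) γ =
            FundamentalGroup.fundamentalGroupMulEquivOfPath p (θ γ)) ∧
        (∃ (f : (𝓡∂ 3).boundary (FlowerHandlebody hg) ≃ₘ⟮𝓡 2, 𝓡 2⟯
            (𝓡∂ 3).boundary (FlowerHandlebody hg)) (p : Path (northPole hg) (f (northPole hg))), ∀ γ,
          FundamentalGroup.map (⟨f, f.continuous⟩ : C(_, _)) (northPole hg) γ =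
            FundamentalGroup.fundamentalGroupMulEquivOfPath p (θ⁻¹ γ))) :
    DehnNielsenBaerSurfaceSmooth := by
  refine dehnNielsenBaerSurfaceSmooth_of_flower_generators fun g hg => ?_
  obtain ⟨S, hS, hreal⟩ := hgen g hg
  refine ⟨northPole hg, S ∪
      (Set.range fun j : ℕ => Homeomorph.fundamentalGroupCongr (rotBoundary hg j).toHomeomorph
        (rotBoundary_northPole hg j)) ∪
      {Homeomorph.fundamentalGroupCongr (reflBoundary hg).toHomeomorph (reflBoundary_northPole hg)},
    hS, ?_⟩
  rintro θ ((hθ | ⟨j, rfl⟩) | hθ)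
  · exact hreal θ hθ
  · exact realised_rotBoundary hg j
  · rw [Set.mem_singleton_iff] at hθ
    subst hθ
    exact realised_reflBoundary hg

end FlowerModel

end Literature.Topology.FourManifolds

end
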